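import Mathlib.MeasureTheory.Integral.Bochner.Set
import Mathlib.Analysis.SpecialFunctions.Pow.Asymptotics
import Mathlib.Analysis.SpecialFunctions.Log.Base
import HarnessLib

/-!
# Doubling of a Hausdorff moment sequence vs doubling of its representing measure at the spectral edge
# — abstract Tauberian core (crux `ExistsScaleCovariantLimit`, stmt-CriticalPhenomena-1981, line `folded-current-repulsion`, F2 record)

Let `μ` be a finite measure carried by `[0,1]` and `g(n) = ∫ tⁿ dμ` its moment sequence (for the critical
axis two-point function of the `ℤ³` Ising model this is the transfer-matrix / Källén–Lehmann spectral
representation, `AizenmanDuminilCopin2021_prop_8_6_holds`). Write `U(y) = μ[e^{-y}, 1]` for the mass within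
spectral gap `y` of the edge `λ = 1`. This file proves the two elementary estimates

* `cheb` — Chebyshev: `e^{-c} U(c/m) ≤ g(m)`;
* `split` — `g(n) ≤ U(L/n) + e^{-L/2} g(⌊n/2⌋)` (split `[0,1]` at `e^{-L/n}`; below it `tⁿ ≤ e^{-L/2} t^{⌊n/2⌋}`),

and the ABELIAN direction of the dictionary (registered sub-goal `edgeDoubling_of_doubling`): if `g` is
positive with one-step ratios bounded below (`r g(k) ≤ g(k+1)`, `k ≥ 1`) and DOUBLING (`κ g(n) ≤ g(2n)`,
`n ≥ 1`), then every representing measure is doubling at the edge: `U(2y) ≤ K U(y)` for `0 < y ≤ y₀`,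
with `A = 2 log(2/(κ r))`, `y₀ = A/2`, `K = (2e^{2A})²`. The Tauberian direction is in the companion file
`…FoldedCurrentSpectralEdgeTauberian`. Together (Ising instance, file `…FoldedCurrentSpectralEdgeDoubling`):
item 6150 `TwoPointDoubling` ⟺ the strategist's `SpectralEdgeDoubling` (census s1, instance UnitLightCone) —
the O-regular-variation Tauberian theorem for Laplace–Stieltjes transforms of de Haan–Stadtmüller in the
special case at hand, with explicit constants and no regular-variation theory.

References: N. H. Bingham, C. M. Goldie, J. L. Teugels, *Regular Variation* (CUP 1987), §2.10 (de Haan–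
Stadtmüller O-version of Karamata's Tauberian theorem) [BinghamGoldieTeugels1987]; L. de Haan,
U. Stadtmüller, *Dominated variation and related concepts and Tauberian theorems for Laplace transforms*,
J. Math. Anal. Appl. 108 (1985) 344–365 [deHaanStadtmuller1985]; M. Aizenman, H. Duminil-Copin, Ann. of
Math. 194 (2021), arXiv:1912.07973, Prop. 5.3 / App. Prop. 8.6, Remark 5.10 [AizenmanDuminilCopinAnnals2021].
-/

noncomputable section

open MeasureTheory Set Filter Real
open scoped Topology

namespace Summit.CriticalPhenomena.Ising3DConformalLimit.Cruxes.ExistsScaleCovariantLimit.FoldedCurrentRepulsion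

namespace SpectralEdge

variable {μ : Measure ℝ} {g : ℕ → ℝ}

/-! ### 1. The representing measure: a.e. support, integrability, monotonicity of moments -/

/-- `μ`-almost every point lies in `[0,1]`. [folklore] -/
theorem ae_mem_Icc (hsupp : μ (Icc (0:ℝ) 1)ᶜ = 0) : ∀ᵐ t ∂μ, t ∈ Icc (0:ℝ) 1 :=
  mem_ae_iff.2 hsupp

/-- Monomials are integrable against a finite measure carried by `[0,1]`. [folklore] -/
theorem integrable_pow [IsFiniteMeasure μ] (hsupp : μ (Icc (0:ℝ) 1)ᶜ = 0) (n : ℕ) :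
    Integrable (fun t : ℝ => t ^ n) μ := by
  refine Integrable.mono' (integrable_const (1:ℝ)) (by fun_prop) ?_
  filter_upwards [ae_mem_Icc hsupp] with t ht
  rw [Real.norm_eq_abs, abs_of_nonneg (pow_nonneg ht.1 n)]
  exact pow_le_one₀ ht.1 ht.2

/-- Moments are nonnegative. [folklore] -/
theorem moment_nonneg (hsupp : μ (Icc (0:ℝ) 1)ᶜ = 0)
    (hrep : ∀ n : ℕ, g n = ∫ t, t ^ n ∂μ) (n : ℕ) : 0 ≤ g n := by
  rw [hrep n]
  refine integral_nonneg_of_ae ?_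
  filter_upwards [ae_mem_Icc hsupp] with t ht
  exact pow_nonneg ht.1 n

/-- Moments are nonincreasing: `g(n+1) ≤ g(n)`. [folklore] -/
theorem moment_succ_le [IsFiniteMeasure μ] (hsupp : μ (Icc (0:ℝ) 1)ᶜ = 0)
    (hrep : ∀ n : ℕ, g n = ∫ t, t ^ n ∂μ) (n : ℕ) : g (n + 1) ≤ g n := by
  rw [hrep n, hrep (n + 1)]
  refine integral_mono_ae (integrable_pow hsupp _) (integrable_pow hsupp _) ?_
  filter_upwards [ae_mem_Icc hsupp] with t ht
  exact pow_le_pow_of_le_one ht.1 ht.2 (Nat.le_succ n)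

/-- Moments are nonincreasing (antitone). [folklore] -/
theorem moment_antitone [IsFiniteMeasure μ] (hsupp : μ (Icc (0:ℝ) 1)ᶜ = 0)
    (hrep : ∀ n : ℕ, g n = ∫ t, t ^ n ∂μ) : Antitone g :=
  antitone_nat_of_succ_le (moment_succ_le hsupp hrep)

/-- `g(0)` is the total mass. [folklore] -/
theorem moment_zero [IsFiniteMeasure μ] (hrep : ∀ n : ℕ, g n = ∫ t, t ^ n ∂μ) :
    g 0 = μ.real univ := by
  rw [hrep 0]
  simp

/-- `U(y) = μ[e^{-y},1]` is nondecreasing in the gap `y`. [folklore] -/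
theorem edge_mono [IsFiniteMeasure μ] {y z : ℝ} (h : y ≤ z) :
    μ.real (Icc (Real.exp (-y)) 1) ≤ μ.real (Icc (Real.exp (-z)) 1) :=
  measureReal_mono (Icc_subset_Icc (Real.exp_le_exp.2 (neg_le_neg h)) le_rfl)

/-- `U(y) ≤ g(0)` (total mass). [folklore] -/
theorem edge_le_moment_zero [IsFiniteMeasure μ] (hrep : ∀ n : ℕ, g n = ∫ t, t ^ n ∂μ) (y : ℝ) :
    μ.real (Icc (Real.exp (-y)) 1) ≤ g 0 := by
  rw [moment_zero hrep]
  exact measureReal_mono (subset_univ _)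

/-! ### 2. The two estimates -/

/-- **Chebyshev at the edge**: `e^{-c}·μ[e^{-c/m}, 1] ≤ g(m)` for `c ≥ 0` (on `[e^{-c/m},1]` one has
`tᵐ ≥ e^{-c}`). [cite: BinghamGoldieTeugels1987, §2.10] -/
theorem cheb [IsFiniteMeasure μ] (hsupp : μ (Icc (0:ℝ) 1)ᶜ = 0)
    (hrep : ∀ n : ℕ, g n = ∫ t, t ^ n ∂μ) (m : ℕ) {c : ℝ} (hc : 0 ≤ c) :
    Real.exp (-c) * μ.real (Icc (Real.exp (-(c / m))) 1) ≤ g m := by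
  have hmeas : MeasurableSet (Icc (Real.exp (-(c / m))) (1:ℝ)) := measurableSet_Icc
  have hint : ∫ t, (Icc (Real.exp (-(c / m))) (1:ℝ)).indicator (fun _ => Real.exp (-c)) t ∂μ =
      Real.exp (-c) * μ.real (Icc (Real.exp (-(c / m))) 1) := by
    rw [integral_indicator_const _ hmeas, smul_eq_mul, mul_comm]
  rw [← hint, hrep m]
  refine integral_mono_ae ((integrable_const _).indicator hmeas) (integrable_pow hsupp m) ?_
  filter_upwards [ae_mem_Icc hsupp] with t ht
  by_cases hmem : t ∈ Icc (Real.exp (-(c / m))) 1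
  · rw [indicator_of_mem hmem]
    rcases Nat.eq_zero_or_pos m with rfl | hm
    · simp only [pow_zero]
      exact Real.exp_le_one_iff.2 (by linarith)
    · calc Real.exp (-c) = Real.exp (-(c / m)) ^ m := by
            rw [← Real.exp_nat_mul]
            congr 1
            field_simp
        _ ≤ t ^ m := pow_le_pow_left₀ (Real.exp_pos _).le hmem.1 m
  · rw [indicator_of_notMem hmem]
    exact pow_nonneg ht.1 m

/-- **The split estimate**: for `L ≥ 0` and `n ≥ 1`, `g(n) ≤ μ[e^{-L/n},1] + e^{-L/2} g(⌊n/2⌋)` — above the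
threshold `tⁿ ≤ 1`, below it `tⁿ = t^{n−⌊n/2⌋} t^{⌊n/2⌋} ≤ e^{-L/2} t^{⌊n/2⌋}`. [cite: BinghamGoldieTeugels1987, §2.10] -/
theorem split [IsFiniteMeasure μ] (hsupp : μ (Icc (0:ℝ) 1)ᶜ = 0)
    (hrep : ∀ n : ℕ, g n = ∫ t, t ^ n ∂μ) {n : ℕ} (hn : 1 ≤ n) {L : ℝ} (hL : 0 ≤ L) :
    g n ≤ μ.real (Icc (Real.exp (-(L / n))) 1) + Real.exp (-(L / 2)) * g (n / 2) := by
  have hmeas : MeasurableSet (Icc (Real.exp (-(L / n))) (1:ℝ)) := measurableSet_Icc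
  set τ : ℝ := Real.exp (-(L / n)) with hτ
  have hτpos : 0 < τ := Real.exp_pos _
  -- the key exponent inequality: `τ^{n - n/2} ≤ e^{-L/2}`
  have hkey : τ ^ (n - n / 2) ≤ Real.exp (-(L / 2)) := by
    rw [hτ, ← Real.exp_nat_mul, Real.exp_le_exp]
    have hn' : (0:ℝ) < n := by exact_mod_cast hn
    have hsub : ((n - n / 2 : ℕ) : ℝ) = (n : ℝ) - ((n / 2 : ℕ) : ℝ) := by
      rw [Nat.cast_sub (Nat.div_le_self n 2)]
    have hhalf : (n : ℝ) ≤ 2 * ((n - n / 2 : ℕ) : ℝ) := by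
      rw [hsub]
      have : 2 * ((n / 2 : ℕ) : ℝ) ≤ (n : ℝ) := by exact_mod_cast Nat.mul_div_le n 2
      linarith
    have key : L / 2 ≤ ((n - n / 2 : ℕ) : ℝ) * (L / n) := by
      calc L / 2 = (L / n * n) / 2 := by field_simp
        _ ≤ (L / n * (2 * ((n - n / 2 : ℕ) : ℝ))) / 2 := by gcongr
        _ = ((n - n / 2 : ℕ) : ℝ) * (L / n) := by ring
    nlinarith [key]
  have hint : ∫ t, ((Icc τ (1:ℝ)).indicator (fun _ => (1:ℝ)) t + Real.exp (-(L / 2)) * t ^ (n / 2)) ∂μ =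
      μ.real (Icc τ 1) + Real.exp (-(L / 2)) * g (n / 2) := by
    rw [integral_add ((integrable_const _).indicator hmeas) ((integrable_pow hsupp _).const_mul _),
      integral_indicator_const _ hmeas, integral_const_mul, ← hrep (n / 2), smul_eq_mul, mul_one]
  rw [← hint, hrep n]
  refine integral_mono_ae (integrable_pow hsupp n)
    (((integrable_const _).indicator hmeas).add ((integrable_pow hsupp _).const_mul _)) ?_
  filter_upwards [ae_mem_Icc hsupp] with t ht
  have hpow_nonneg : 0 ≤ Real.exp (-(L / 2)) * t ^ (n / 2) := mul_nonneg (Real.exp_pos _).le (pow_nonneg ht.1 _)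
  by_cases hmem : t ∈ Icc τ 1
  · rw [indicator_of_mem hmem]
    have : t ^ n ≤ 1 := pow_le_one₀ ht.1 ht.2
    linarith
  · rw [indicator_of_notMem hmem, zero_add]
    have htlt : t ≤ τ := by
      simp only [mem_Icc, not_and_or, not_le] at hmem
      rcases hmem with h | h
      · exact h.le
      · exact absurd ht.2 (not_le.2 h)
    calc t ^ n = t ^ (n - n / 2) * t ^ (n / 2) := by
          rw [← pow_add, Nat.sub_add_cancel (Nat.div_le_self n 2)]
      _ ≤ τ ^ (n - n / 2) * t ^ (n / 2) :=
          mul_le_mul_of_nonneg_right (pow_le_pow_left₀ ht.1 htlt _) (pow_nonneg ht.1 _)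
      _ ≤ Real.exp (-(L / 2)) * t ^ (n / 2) := mul_le_mul_of_nonneg_right hkey (pow_nonneg ht.1 _)

/-! ### 3. The Abelian direction: doubling of the moments ⟹ doubling at the spectral edge -/

/-- **Integer form**: under doubling `κ g(n) ≤ g(2n)` and the ratio bound `r g(k) ≤ g(k+1)` (`k ≥ 1`), with
`A = 2 log(2/(κ r))`: `g(m) ≤ 2 μ[e^{-A/m}, 1]` for every `m ≥ 2` (the split estimate with `L = A`: the lower part
is at most `e^{-A/2} g(⌊m/2⌋) ≤ (κ r/2)·g(m)/(κ r)`). [cite: BinghamGoldieTeugels1987, §2.10] -/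
theorem moment_le_two_mul_edge [IsFiniteMeasure μ] (hsupp : μ (Icc (0:ℝ) 1)ᶜ = 0)
    (hrep : ∀ n : ℕ, g n = ∫ t, t ^ n ∂μ) (hpos : ∀ n, 0 < g n)
    {r : ℝ} (hr : 0 < r) (hratio : ∀ k : ℕ, 1 ≤ k → r * g k ≤ g (k + 1))
    {κ : ℝ} (hκ : 0 < κ) (hdbl : ∀ n : ℕ, 1 ≤ n → κ * g n ≤ g (2 * n))
    {m : ℕ} (hm : 2 ≤ m) :
    g m ≤ 2 * μ.real (Icc (Real.exp (-(2 * Real.log (2 / (κ * r)) / m))) 1) := by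
  set A : ℝ := 2 * Real.log (2 / (κ * r)) with hA
  -- `κ ≤ 1`, `r ≤ 1`, so `A ≥ 0` and `e^{-A/2} = κ r / 2`
  have hκ1 : κ ≤ 1 := by
    have h := hdbl 1 le_rfl
    have h2 : g (2 * 1) ≤ g 1 := moment_antitone hsupp hrep (by norm_num)
    nlinarith [hpos 1]
  have hr1 : r ≤ 1 := by
    have h := hratio 1 le_rfl
    have h2 : g (1 + 1) ≤ g 1 := moment_succ_le hsupp hrep 1
    nlinarith [hpos 1]
  have hκr : 0 < κ * r := mul_pos hκ hr
  have hκr1 : κ * r ≤ 1 := by nlinarith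
  have hA0 : 0 ≤ A := by
    rw [hA]
    refine mul_nonneg (by norm_num) (Real.log_nonneg ?_)
    rw [le_div_iff₀ hκr]; linarith
  have hexpA : Real.exp (-(A / 2)) = κ * r / 2 := by
    rw [hA, show -(2 * Real.log (2 / (κ * r)) / 2) = -Real.log (2 / (κ * r)) by ring, Real.exp_neg,
      Real.exp_log (by positivity)]
    field_simp
  have hsplit := split hsupp hrep (show 1 ≤ m by omega) hA0 (n := m)
  -- the lower part: `g(⌊m/2⌋) ≤ g(m)/(κ r)`
  have hm2 : 1 ≤ m / 2 := by omega
  have h1 : κ * g (m / 2) ≤ g (2 * (m / 2)) := hdbl (m / 2) hm2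
  have h2 : g (2 * (m / 2)) ≤ g (m - 1) := moment_antitone hsupp hrep (by omega)
  have h3 : r * g (m - 1) ≤ g m := by
    have := hratio (m - 1) (by omega)
    rwa [Nat.sub_add_cancel (by omega : 1 ≤ m)] at this
  have hlow : κ * r * g (m / 2) ≤ g m := by
    calc κ * r * g (m / 2) = r * (κ * g (m / 2)) := by ring
      _ ≤ r * g (m - 1) := mul_le_mul_of_nonneg_left (h1.trans h2) hr.le
      _ ≤ g m := h3
  have : Real.exp (-(A / 2)) * g (m / 2) ≤ g m / 2 := by
    rw [hexpA]
    have : κ * r / 2 * g (m / 2) = (κ * r * g (m / 2)) / 2 := by ring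
    rw [this]
    linarith
  linarith

/-- **ABELIAN DIRECTION OF THE DICTIONARY** (registered sub-goal `edgeDoubling_of_doubling` of item 1981,
abstract form): if a Hausdorff moment sequence `g(n) = ∫_{[0,1]} tⁿ dμ` is positive, has one-step ratios
bounded below (`r g(k) ≤ g(k+1)`, `k ≥ 1`) and is DOUBLING (`κ g(n) ≤ g(2n)`, `n ≥ 1`), then `μ` is a doubling
measure at the spectral edge `λ = 1`: with `A = 2 log(2/(κ r))`, `μ[e^{-2y},1] ≤ (2e^{2A})² μ[e^{-y},1]` for
`0 < y ≤ A/2`. (Integer skeleton: `μ[e^{-2A/m},1] ≤ e^{2A} g(m) ≤ 2e^{2A} μ[e^{-A/m},1]`, `m ≥ 2`; a real `y` is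
squeezed between `A/(m+1)` and `A/m`.) [cite: BinghamGoldieTeugels1987, §2.10] [cite: deHaanStadtmuller1985, Thm 1] -/
theorem edgeDoubling_of_doubling : ∀ {μ : MeasureTheory.Measure ℝ} {g : ℕ → ℝ}, MeasureTheory.IsFiniteMeasure μ → μ (Set.Icc (0:ℝ) 1)ᶜ = 0 → (∀ n : ℕ, g n = ∫ t, t ^ n ∂μ) → (∀ n : ℕ, 0 < g n) → (∃ r : ℝ, 0 < r ∧ ∀ k : ℕ, 1 ≤ k → r * g k ≤ g (k + 1)) → (∃ κ : ℝ, 0 < κ ∧ ∀ n : ℕ, 1 ≤ n → κ * g n ≤ g (2 * n)) → ∃ K y₀ : ℝ, 0 < K ∧ 0 < y₀ ∧ ∀ y ∈ Set.Ioc (0:ℝ) y₀, μ.real (Set.Icc (Real.exp (-(2 * y))) 1) ≤ K * μ.real (Set.Icc (Real.exp (-y)) 1) := by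
  intro μ g hfin hsupp hrep hpos hr hκ
  obtain ⟨r, hr, hratio⟩ := hr
  obtain ⟨κ, hκ, hdbl⟩ := hκ
  set A : ℝ := 2 * Real.log (2 / (κ * r)) with hA
  have hκ1 : κ ≤ 1 := by
    have h := hdbl 1 le_rfl
    have h2 : g (2 * 1) ≤ g 1 := moment_antitone hsupp hrep (by norm_num)
    nlinarith [hpos 1]
  have hr1 : r ≤ 1 := by
    have h := hratio 1 le_rfl
    have h2 : g (1 + 1) ≤ g 1 := moment_succ_le hsupp hrep 1
    nlinarith [hpos 1]
  have hκr : 0 < κ * r := mul_pos hκ hr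
  have hApos : 0 < A := by
    rw [hA]
    refine mul_pos (by norm_num) (Real.log_pos ?_)
    rw [lt_div_iff₀ hκr]; nlinarith
  -- integer skeleton: `U(2A/m) ≤ 2 e^{2A} U(A/m)` for `m ≥ 2`
  set K₁ : ℝ := 2 * Real.exp (2 * A) with hK₁
  have hK₁pos : 0 < K₁ := by positivity
  have hstep : ∀ m : ℕ, 2 ≤ m →
      μ.real (Icc (Real.exp (-(2 * A / m))) 1) ≤ K₁ * μ.real (Icc (Real.exp (-(A / m))) 1) := by
    intro m hm
    have hU : μ.real (Icc (Real.exp (-(2 * A / m))) 1) ≤ Real.exp (2 * A) * g m := by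
      have h := cheb hsupp hrep m (c := 2 * A) (by linarith)
      have hee : Real.exp (2 * A) * Real.exp (-(2 * A)) = 1 := by
        rw [← Real.exp_add, add_neg_cancel, Real.exp_zero]
      calc μ.real (Icc (Real.exp (-(2 * A / m))) 1)
          = 1 * μ.real (Icc (Real.exp (-(2 * A / m))) 1) := (one_mul _).symm
        _ = (Real.exp (2 * A) * Real.exp (-(2 * A))) * μ.real (Icc (Real.exp (-(2 * A / m))) 1) := by
            rw [hee]
        _ = Real.exp (2 * A) * (Real.exp (-(2 * A)) * μ.real (Icc (Real.exp (-(2 * A / m))) 1)) :=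
            mul_assoc _ _ _
        _ ≤ Real.exp (2 * A) * g m := mul_le_mul_of_nonneg_left h (Real.exp_pos _).le
    have hg : g m ≤ 2 * μ.real (Icc (Real.exp (-(A / m))) 1) := by
      have := moment_le_two_mul_edge hsupp hrep hpos hr hratio hκ hdbl hm
      simpa only [hA] using this
    calc μ.real (Icc (Real.exp (-(2 * A / m))) 1) ≤ Real.exp (2 * A) * g m := hU
      _ ≤ Real.exp (2 * A) * (2 * μ.real (Icc (Real.exp (-(A / m))) 1)) :=
          mul_le_mul_of_nonneg_left hg (Real.exp_pos _).le
      _ = K₁ * μ.real (Icc (Real.exp (-(A / m))) 1) := by rw [hK₁]; ring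
  refine ⟨K₁ * K₁, A / 2, mul_pos hK₁pos hK₁pos, by linarith, fun y hy => ?_⟩
  obtain ⟨hy0, hyA⟩ := hy
  -- `m = ⌊A/y⌋ ≥ 2`, `A/(m+1) < y ≤ A/m`
  set m : ℕ := ⌊A / y⌋₊ with hm
  have hAy : 2 ≤ A / y := by rw [le_div_iff₀ hy0]; linarith
  have hm2 : 2 ≤ m := by
    rw [hm]
    exact Nat.le_floor (by exact_mod_cast hAy)
  have hmpos : (0:ℝ) < m := by exact_mod_cast (show 0 < m by omega)
  have hfloor_le : (m : ℝ) ≤ A / y := Nat.floor_le (by positivity)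
  have hlt_floor : A / y < (m : ℝ) + 1 := Nat.lt_floor_add_one _
  have hy_le : y ≤ A / m := by
    rw [le_div_iff₀ hmpos]
    calc y * m ≤ y * (A / y) := mul_le_mul_of_nonneg_left hfloor_le hy0.le
      _ = A := by field_simp
  have hy_ge : A / ((m : ℝ) + 1) ≤ y := by
    rw [div_le_iff₀ (by positivity)]
    calc A = (A / y) * y := by field_simp
      _ ≤ ((m : ℝ) + 1) * y := mul_le_mul_of_nonneg_right hlt_floor.le hy0.le
      _ = y * ((m : ℝ) + 1) := by ring
  -- chain
  have e1 : μ.real (Icc (Real.exp (-(2 * y))) 1) ≤ μ.real (Icc (Real.exp (-(2 * A / m))) 1) :=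
    edge_mono (by rw [mul_div_assoc]; exact mul_le_mul_of_nonneg_left hy_le (by norm_num))
  have e2 := hstep m hm2
  have e3 : μ.real (Icc (Real.exp (-(A / m))) 1) ≤ μ.real (Icc (Real.exp (-(2 * A / ((m + 1 : ℕ) : ℝ)))) 1) := by
    refine edge_mono ?_
    rw [div_le_div_iff₀ hmpos (by positivity)]
    push_cast
    nlinarith [hApos.le, hmpos]
  have e4 := hstep (m + 1) (by omega)
  have e5 : μ.real (Icc (Real.exp (-(A / ((m + 1 : ℕ) : ℝ)))) 1) ≤ μ.real (Icc (Real.exp (-y)) 1) := by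
    refine edge_mono ?_
    push_cast
    exact hy_ge
  have hU0 : 0 ≤ μ.real (Icc (Real.exp (-(A / m))) 1) := measureReal_nonneg
  calc μ.real (Icc (Real.exp (-(2 * y))) 1)
      ≤ K₁ * μ.real (Icc (Real.exp (-(A / m))) 1) := e1.trans e2
    _ ≤ K₁ * μ.real (Icc (Real.exp (-(2 * A / ((m + 1 : ℕ) : ℝ)))) 1) := mul_le_mul_of_nonneg_left e3 hK₁pos.le
    _ ≤ K₁ * (K₁ * μ.real (Icc (Real.exp (-(A / ((m + 1 : ℕ) : ℝ)))) 1)) := mul_le_mul_of_nonneg_left e4 hK₁pos.le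
    _ ≤ K₁ * (K₁ * μ.real (Icc (Real.exp (-y)) 1)) :=
        mul_le_mul_of_nonneg_left (mul_le_mul_of_nonneg_left e5 hK₁pos.le) hK₁pos.le
    _ = K₁ * K₁ * μ.real (Icc (Real.exp (-y)) 1) := by ring

end SpectralEdge

end Summit.CriticalPhenomena.Ising3DConformalLimit.Cruxes.ExistsScaleCovariantLimit.FoldedCurrentRepulsion

end
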